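import Summits.Ventures.PercRepro.C041InvStarCountR

/-!
# LEMMA (INV-STAR) from its closed forms: the termwise inequality (p6, gen 25; C-041.md §10 (f))

With the two closed forms `card_Lset` / `card_Rset`, the paper's proof of (INV-STAR) is one line: re-index the left
side by `A ↔ Ā` (`sum_L_reindex`) and compare term by term — `s_Ā (2^{k_t(A)} − 1) ≤ 2^{k_j(Ā)} (2^{k_t(A)} − s_A)`
because `s ≤ 1` (`termwise_le`); hence `#Lset ≤ #Rset` (`card_Lset_le_card_Rset`), the inequality
`invalidCountS_le_mCountS` of `C041InvStar` obtained there by the explicit injection.  Equality holds termwise when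
every leaf is `t`-typed (`k_j ≡ 0`, `s ≡ 1`) — the tight families of the census.
-/

namespace PercRepro

namespace InvStar

open Finset

variable {ι : Type*} [Fintype ι] [DecidableEq ι] (kt ko : ι → ℕ)

/-- `s_A ≤ 1`. -/
theorem sProd_le_one (A : Finset ι) : sProd kt ko A ≤ 1 := by
  rw [sProd_eq]
  split_ifs <;> omega

/-- **THE TERMWISE INEQUALITY** (C-041.md §10 (f)): after the re-indexing `A ↔ Ā` of the left side,
`s_Ā (2^{k_t(A)} − 1) ≤ 2^{k_j(Ā)} (2^{k_t(A)} − s_A)`, because `s ≤ 1`. -/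
theorem termwise_le (A : Finset ι) :
    sProd kt ko Aᶜ * (2 ^ ktIn kt A - 1) ≤ 2 ^ koBar ko A * (2 ^ ktIn kt A - sProd kt ko A) := by
  have h1 := sProd_le_one kt ko Aᶜ
  have h2 := sProd_le_one kt ko A
  have h3 : 1 ≤ 2 ^ koBar ko A := Nat.one_le_two_pow
  calc sProd kt ko Aᶜ * (2 ^ ktIn kt A - 1) ≤ 1 * (2 ^ ktIn kt A - 1) := Nat.mul_le_mul_right _ h1
    _ ≤ 1 * (2 ^ ktIn kt A - sProd kt ko A) := Nat.mul_le_mul_left _ (Nat.sub_le_sub_left h2 _)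
    _ ≤ 2 ^ koBar ko A * (2 ^ ktIn kt A - sProd kt ko A) := Nat.mul_le_mul_right _ h3

/-- The left side re-indexed by `A ↔ Ā`: `Σ_A s_A (2^{k_t(Ā)} − 1) = Σ_A s_Ā (2^{k_t(A)} − 1)`. -/
theorem sum_L_reindex :
    ∑ A : Finset ι, sProd kt ko A * (2 ^ ktBar kt A - 1)
      = ∑ A : Finset ι, sProd kt ko Aᶜ * (2 ^ ktIn kt A - 1) := by
  refine Fintype.sum_equiv ⟨compl, compl, compl_compl, compl_compl⟩ _ _ fun A => ?_
  simp only [Equiv.coe_fn_mk, compl_compl]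
  rfl

open Classical in
/-- **LEMMA (INV-STAR) FROM THE CLOSED FORMS** (C-041.md §10 (f)): `#Lset ≤ #Rset`, termwise after `A ↔ Ā`. -/
theorem card_Lset_le_card_Rset : (Lset kt ko).card ≤ (Rset kt ko).card := by
  rw [card_Lset, card_Rset, sum_L_reindex]
  exact Finset.sum_le_sum fun A _ => termwise_le kt ko A

end InvStar

end PercRepro
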